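import Literature.MathematicalPhysics.QuantumFieldTheory.Balaban1983to89.B9Ineq3137LocalSup
import Literature.MathematicalPhysics.QuantumFieldTheory.Balaban1983to89.B9Eq383QSemiLocal
import Literature.MathematicalPhysics.QuantumFieldTheory.Balaban1983to89.B9Eq315QTowerLipschitz
import Literature.MathematicalPhysics.QuantumFieldTheory.Balaban1983to89.B9Eq326OperatorTower
import Literature.MathematicalPhysics.QuantumFieldTheory.Balaban1983to89.B9Eq342TowerBigBlocks

/-!
# `Balaban1983to89.B9Eq315QkLocalLetter` — T. Bałaban, *Propagators for lattice gauge theories in a background field*, Commun. Math. Phys. **99** (1985)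
# 389–434 [Balaban1985BackgroundPropagators] (3.15)–(3.16) p. 393 *«Q_k(U) = Q(Ū^{k−1})…Q(U)»*, Thm 3.1 (3.42) p. 397, (3.153) p. 426, with
# [Balaban1985Averaging] p. 24 *«this definition is local … depends only on the bond variables … b ⊂ B^k(c₋) ∪ B^k(c₊)»*, (126)–(127) pp. 36–37:
# **THE (3.42)-LETTER OF THE COMPOSITE VECTOR AVERAGING `Q_k(U)` OVER THE BIG BLOCKS — (L)(Q_k(U); ∏_{j<k}(1 + 50(d+1)α_j)·e^{κ}, κ) FOR EVERY
# `κ ≥ 0`**, and for the chain's `B9Eq326OperatorTower.QkW` on the weighted `L²` carriers (fibre letters `M_φ`, `M_φ′`): the composite is LOCAL with range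
# ONE big block (the cell's `linCovIter_congr` on the box `B^k(c₋) ∪ B^k(c₊)` of [B7] p. 24, read on the torus through `B9Eq315QTower.QkOfU_apply_eq_linCovIter`)
# and sup-bounded by the PRODUCT of the level constants of [B7] (126) (HEIGHT-FREE when `Σ_j α_j` is) — the `hQl` inhabitant of this lineage's
# `B9Eq3153FrakGkLocalLetter.local_letter_frakGk_of_letters` (pub-balaban NE9 owner's plan v10 §6 OPEN (4), tower storey)

statement-level skeleton of published theorems with citation tags; proofs where landed; nothing here is a claim about the Yang–Mills mass gap

CITATION HEADER (lean-in-tree rule).  Audit cell `pub-balaban`, sub-cell `t4`, BINDER row NE9; filed by NE9 crux-team LEAF PROVER 03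
(`b2b-balaban-t4-ne9-formalise-leaf-03`, gen 72).  Sources READ in the held renders: [Balaban1985BackgroundPropagators] p. 393 (3.15)–(3.16), p. 397 (3.42);
[Balaban1985Averaging] p. 24, pp. 36–37 (126)–(127).  NOTHING printed is asserted: the per-level block-loop regularity `α_j ≤ 1∕64` (`hreg`), unit-boundedness
(`hU1`) and the fibre letters are DISPLAYED; [folklore] one-big-block-range bookkeeping.

WHAT IS PROVED (sorry-free; proof lane — no `def`; context = `B9Eq315QTower` §2–§3's: `L ≥ 1`, `m`, height `k`, background `U` on `T_{(L^k m)}`, `α`, `hα1`,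
`hU1`, `hreg`).
* §1 geometry: **`siteCast_perSite`** (reading a `ℤ^d` site on `T_{towerP}` or on `T_{fineP (L^k)}` is the same site); **`bigBlock_perSite_of_inBoxK`** — a
  `ℤ^d` site of the box `[L^k·y, L^k·y + (L^k − 1)𝟙 + L^k e_κ]` reads on `T_{(L^k m)}` in the big block `Π⁻¹(y)` or `Π⁻¹(y + e_κ)`
  (`B9Eq383QSemiLocal.blockCoord_perSite_of_inBox` at block size `L^k`).
* §2 **`QkOfU_apply_eq_zero_of_support`** — `A` supported on the fine bonds based in `Π⁻¹(v)`, `c₋ ≠ v`, `c₋ + e_{c.2} ≠ v` ⟹ `(Q_k(U)A)(c) = 0`;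
  **`norm_Qtower_apply_le_prod`** — `‖(Q_nA)(c)‖ ≤ (∏_{j<n}(1 + 50(d+1)α_j))·sup‖A‖` (any level backgrounds; `B9Eq315QTowerLipschitz.norm_QtorusLin_apply_le`
  at every level); **`local_QkOfU`** — the letter `‖(Q_k(U)A)(c)‖ ≤ (∏_{j<k}(1 + 50(d+1)α_j))·e^{κ}·e^{−κ·d_m(c₋,v)}·sup‖A‖` (`κ ≥ 0`, `1 ≤ m_i`).
* §3 **`local_QkW`** — the same for `WL2.equiv (QkW L m n φ U hL α hα1 hU1 hreg f) c` with constant `M_φ′·M_φ·(∏_{j<n+1}(1 + 50(d+1)α_j))·e^{κ}` — VERBATIM the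
  `hQl` binder of `B9Eq3153FrakGkLocalLetter.local_letter_frakGk_of_letters`.
HONEST SCOPE.  One factor's letter; no decay produced (`e^{κ}` pays for the one-block range); the adjoint `Q_k(U)†` is NOT here; nothing of (3.42)∕Thm 3.1
asserted; NOT NE9 (cell pub-balaban: NE9 NOT PRINTED ∕ NOT PROVED; «NE9 ⇐ the named binders»; row WALLED ON A MODEL (O-NE9-1; #5 UNRULED); spine PROVED
0∕9; rung (B)+1 on a finite T⁴ — NOT infinite volume, NOT mass gap, NOT Clay; HONEST DEPENDENCY: continuum YM on T⁴ ⇐ BetaPertH ∧ nine spine estimates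
(0/9 proved); BetaPertH ⇐ (D1) ∧ (D4) ∧ CAP+tail; G-an2-4 gates asym, D1 and NE2/3/4).  NEW file; nothing modified.  Net new unproved facts: 0.
-/

noncomputable section

open scoped BigOperators

namespace Literature.MathematicalPhysics.QuantumFieldTheory.Balaban1983to89.B9Eq315QkLocalLetter

open B4Sect5Torus (TSite tdist tdist_self)
open B9SectCLatticeCarrier (Bond bpos shift)
open B7Prop1Explicit (U1 Wcx boxVec)
open B7Prop1Local (InBox loK bondHiK bondHi)
open B9Eq311L2Pairing (WL2)
open B11Eq103H1Complex (BondL2K)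
open B9Eq319QprimeTorus (fineP blockCoord)
open B9Eq315QTorus (perCfg perSite cornerSite QtorusLin)
open B9Eq315QTorusOnto (liftSite)
open B9Eq315QTower (towerP towerP_apply UlevOf Qtower QkOfU QkOfU_apply_eq_linCovIter)
open B9Eq316TowerFlatIsOneStep (towerP_eq_fineP_pow siteCast siteCast_apply_val)
open B9Eq326OperatorTower (QkW)
open B9Eq383QSemiLocal (blockCoord_perSite_of_inBox)
open B9Eq315QTowerLipschitz (norm_QtorusLin_apply_le)
open B9Ineq3137LocalSup (linCovIter_congr)
open B9Eq349BlockDistanceWeight (tdist_shift_le_one)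

/-! ## §1 Geometry: `ℤ^d` boxes of side `L^k` read on the tower torus -/

section Geometry

variable {d : ℕ} (L : ℕ) [NeZero L] (m : Fin d → ℕ) [∀ i, NeZero (m i)] (k : ℕ)

omit [NeZero L] [∀ i, NeZero (m i)] in
/-- reading a `ℤ^d` site on the torus with periods `P` or `P′ = P` gives the same site under the site cast. [cite: Balaban1985Averaging, (1) p.17] -/
theorem siteCast_perSite {P P' : Fin d → ℕ} [∀ i, NeZero (P i)] [∀ i, NeZero (P' i)] (h : P = P') (x : B7Prop1Explicit.Site d) :
    siteCast h (perSite P x) = perSite P' x := by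
  subst h
  funext i
  apply Fin.ext
  rw [siteCast_apply_val]

/-- **THE `ℤ^d` BOX OF A COARSE BOND AT HEIGHT `k` PROJECTS INTO `B^k(c₋) ∪ B^k(c₊)`**: a site `x` with `L^k·y_i ≤ x_i ≤ L^k·y_i + (L^k − 1) + L^k·δ_{iκ}` (the
box `[loK L k y, bondHiK L k y κ]` of the cell's composite locality) reads on `T_{(L^k m)}` in the big block `Π⁻¹(y)` or `Π⁻¹(y + e_κ)`
(`Π = blockCoord (L^k) m ∘ siteCast`). [cite: Balaban1985Averaging, p.24, (2) p.17; Balaban1985BackgroundPropagators, (3.15)–(3.16) p.393] -/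
theorem bigBlock_perSite_of_inBoxK (y : TSite d m) (κ : Fin d) (x : B7Prop1Explicit.Site d)
    (hx : InBox (loK L k (liftSite y)) (bondHiK L k (liftSite y) κ) x) :
    blockCoord (L ^ k) m (siteCast (towerP_eq_fineP_pow L m k) (perSite (towerP L m k) x)) = y ∨
      blockCoord (L ^ k) m (siteCast (towerP_eq_fineP_pow L m k) (perSite (towerP L m k) x)) = shift κ y := by
  haveI : ∀ i, NeZero (fineP (L ^ k) m i) := fun i => ⟨Nat.mul_ne_zero (pow_ne_zero _ (NeZero.ne L)) (NeZero.ne (m i))⟩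
  rw [siteCast_perSite]
  refine blockCoord_perSite_of_inBox (L ^ k) m y κ x fun i => ?_
  have h := hx i
  simp only [loK, bondHiK, liftSite] at h
  simp only [cornerSite, bondHi, Nat.cast_pow]
  exact h

end Geometry

/-! ## §2 The composite `Q_k(U)` on the torus: support, sup, letter -/

section Tower

variable {d : ℕ} (L : ℕ) [NeZero L] (m : Fin d → ℕ) [∀ i, NeZero (m i)]
  {𝔸 : Type*} [NormedRing 𝔸] [NormedAlgebra ℂ 𝔸] [CompleteSpace 𝔸] [NormOneClass 𝔸] (hL : 1 ≤ L)

/-- **THE COMPOSITE AVERAGING IS BOUNDED BY THE PRODUCT OF THE LEVEL CONSTANTS**: `‖(Q_n A)(c)‖ ≤ (∏_{j<n}(1 + 50(d+1)α_j))·sup‖A‖` for ANY family of level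
backgrounds (`B9Eq315QTowerLipschitz.norm_QtorusLin_apply_le` = [B7] (126) at every level torus; cf. the `2^n` of
`B9Eq315QTowerLipschitzTwoBackgrounds.norm_Qtower_apply_le`). [cite: Balaban1985Averaging, (126) p.36; Balaban1985BackgroundPropagators, (3.15) p.393] -/
theorem norm_Qtower_apply_le_prod (Ulev : (n : ℕ) → Bond d (towerP L m (n + 1)) → 𝔸ˣ) (α : ℕ → ℝ) (hα1 : ∀ n, α n ≤ 1 / 64)
    (hU1 : ∀ (n : ℕ) (x : B7Prop1Explicit.Site d) (κ : Fin d), perCfg (towerP L m (n + 1)) (Ulev n) x κ ∈ U1 𝔸)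
    (hreg : ∀ (n : ℕ) (y : TSite d (towerP L m n)) (κ : Fin d) (r : Fin d → Fin L),
      ‖((Wcx L (perCfg (towerP L m (n + 1)) (Ulev n)) (cornerSite L y) κ (boxVec L r) : 𝔸ˣ) : 𝔸) - 1‖ ≤ α n) :
    ∀ (n : ℕ) (A : Bond d (towerP L m n) → 𝔸) {a : ℝ}, 0 ≤ a → (∀ b, ‖A b‖ ≤ a) → ∀ c : Bond d m,
      ‖Qtower L m hL Ulev α hα1 hU1 hreg n A c‖ ≤ (∏ j ∈ Finset.range n, (1 + 50 * (d + 1) * α j)) * a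
  | 0, A, a, _, hA, c => by
    rw [Finset.prod_range_zero, one_mul]
    exact hA c
  | n + 1, A, a, ha, hA, c => by
    have hα0 : 0 ≤ α n := (norm_nonneg _).trans (hreg n (fun i => ⟨0, Nat.pos_of_ne_zero (NeZero.ne _)⟩) c.2 fun _ => ⟨0, hL⟩)
    have hC : 0 ≤ 1 + 50 * ((d : ℝ) + 1) * α n := by positivity
    rw [show Qtower L m hL Ulev α hα1 hU1 hreg (n + 1) A c =
        Qtower L m hL Ulev α hα1 hU1 hreg n (QtorusLin L (towerP L m n) hL (Ulev n) (hα1 n) (hU1 n) (hreg n) A) c from rfl,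
      Finset.prod_range_succ, mul_assoc]
    exact norm_Qtower_apply_le_prod Ulev α hα1 hU1 hreg n _ (mul_nonneg hC ha)
      (fun b => norm_QtorusLin_apply_le L (towerP L m n) hL (Ulev n) (hα1 n) (hU1 n) (hreg n) A ha hA b) c

variable (k : ℕ) (U : Bond d (towerP L m k) → 𝔸ˣ) (α : ℕ → ℝ) (hα1 : ∀ n, α n ≤ 1 / 64)
  (hU1 : ∀ (n : ℕ) (x : B7Prop1Explicit.Site d) (κ : Fin d), perCfg (towerP L m (n + 1)) (UlevOf L m k U n) x κ ∈ U1 𝔸)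
  (hreg : ∀ (n : ℕ) (y : TSite d (towerP L m n)) (κ : Fin d) (r : Fin d → Fin L),
    ‖((Wcx L (perCfg (towerP L m (n + 1)) (UlevOf L m k U n)) (cornerSite L y) κ (boxVec L r) : 𝔸ˣ) : 𝔸) - 1‖ ≤ α n)

/-- **`Q_k(U)` HAS RANGE ONE BIG BLOCK**: if `A` vanishes on every fine bond based outside the big block `Π⁻¹(v)` of `T_{(L^k m)}`, then `(Q_k(U)A)(c) = 0`
unless `v ∈ {c₋, c₋ + e_{c.2}}` — the cell's composite locality `linCovIter_congr` ([B7] p. 24) on the box `B^k(c₋) ∪ B^k(c₊)`, read on the torus through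
`B9Eq315QTower.QkOfU_apply_eq_linCovIter`, against `A′ = 0`. [folklore] [cite: Balaban1985Averaging, p.24, (127) p.37; Balaban1985BackgroundPropagators, (3.15)–(3.16) p.393] -/
theorem QkOfU_apply_eq_zero_of_support (v : TSite d m) (A : Bond d (towerP L m k) → 𝔸)
    (hAv : ∀ b, blockCoord (L ^ k) m (siteCast (towerP_eq_fineP_pow L m k) b.1) ≠ v → A b = 0)
    (c : Bond d m) (h1 : c.1 ≠ v) (h2 : shift c.2 c.1 ≠ v) : QkOfU L m hL k U α hα1 hU1 hreg A c = 0 := by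
  have h : QkOfU L m hL k U α hα1 hU1 hreg A c = QkOfU L m hL k U α hα1 hU1 hreg 0 c := by
    rw [QkOfU_apply_eq_linCovIter, QkOfU_apply_eq_linCovIter]
    congr 1
    refine linCovIter_congr L hL k (liftSite c.1) c.2 (fun _ _ _ _ => rfl) fun x μ hx _ => ?_
    rw [B9Eq315QTorus.perCfg_apply, B9Eq315QTorus.perCfg_apply, Pi.zero_apply]
    rcases bigBlock_perSite_of_inBoxK L m k c.1 c.2 x hx with hb | hb
    · exact hAv _ (by rw [hb]; exact h1)
    · exact hAv _ (by rw [hb]; exact h2)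
  rw [h, map_zero, Pi.zero_apply]

/-- **THE COMPOSITE VECTOR AVERAGING `Q_k(U)` CARRIES THE LETTER (L) AT EVERY RATE `κ ≥ 0`** over the big blocks (block of a coarse bond = its base point;
`1 ≤ m_i`): for `A` supported on the fine bonds based in `Π⁻¹(v)` with `‖A(b)‖ ≤ a`,
`‖(Q_k(U)A)(c)‖ ≤ (∏_{j<k}(1 + 50(d+1)α_j))·e^{κ}·e^{−κ·d_m(c₋,v)}·a`. [folklore]
[cite: Balaban1985BackgroundPropagators, (3.15)–(3.16) p.393, Thm 3.1 (3.42) p.397, (3.153) p.426; Balaban1985Averaging, (126)–(127) pp.36–37] -/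
theorem local_QkOfU (hm : ∀ i, 1 ≤ m i) {κ : ℝ} (hκ : 0 ≤ κ) (v : TSite d m) (A : Bond d (towerP L m k) → 𝔸) (a : ℝ)
    (hAv : ∀ b, blockCoord (L ^ k) m (siteCast (towerP_eq_fineP_pow L m k) b.1) ≠ v → A b = 0) (hAa : ∀ b, ‖A b‖ ≤ a) (c : Bond d m) :
    ‖QkOfU L m hL k U α hα1 hU1 hreg A c‖ ≤
      (∏ j ∈ Finset.range k, (1 + 50 * (d + 1) * α j)) * Real.exp κ * Real.exp (-(κ * tdist m c.1 v)) * a := by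
  rcases Nat.eq_zero_or_pos d with hd | hd
  · subst hd; exact c.2.elim0
  have ha : 0 ≤ a := (norm_nonneg _).trans (hAa ((fun i => ⟨0, Nat.pos_of_ne_zero (NeZero.ne _)⟩), c.2))
  have hC : 0 ≤ ∏ j ∈ Finset.range k, (1 + 50 * ((d : ℝ) + 1) * α j) :=
    Finset.prod_nonneg fun j _ => by
      have hα0 : 0 ≤ α j :=
        (norm_nonneg _).trans (hreg j (fun i => ⟨0, Nat.pos_of_ne_zero (NeZero.ne _)⟩) c.2 fun _ => ⟨0, hL⟩)
      positivity
  have hsup : ‖QkOfU L m hL k U α hα1 hU1 hreg A c‖ ≤ (∏ j ∈ Finset.range k, (1 + 50 * ((d : ℝ) + 1) * α j)) * a :=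
    norm_Qtower_apply_le_prod L m hL (UlevOf L m k U) α hα1 hU1 hreg k A ha hAa c
  have hcomp : ∀ {D : ℝ}, D ≤ 1 → (∏ j ∈ Finset.range k, (1 + 50 * ((d : ℝ) + 1) * α j)) * a ≤
      (∏ j ∈ Finset.range k, (1 + 50 * ((d : ℝ) + 1) * α j)) * Real.exp κ * Real.exp (-(κ * D)) * a := fun {D} hD => by
    have h1 : (1 : ℝ) ≤ Real.exp κ * Real.exp (-(κ * D)) := by
      rw [← Real.exp_add]
      exact Real.one_le_exp (by nlinarith [mul_le_mul_of_nonneg_left hD hκ])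
    calc (∏ j ∈ Finset.range k, (1 + 50 * ((d : ℝ) + 1) * α j)) * a
        = (∏ j ∈ Finset.range k, (1 + 50 * ((d : ℝ) + 1) * α j)) * a * 1 := (mul_one _).symm
      _ ≤ (∏ j ∈ Finset.range k, (1 + 50 * ((d : ℝ) + 1) * α j)) * a * (Real.exp κ * Real.exp (-(κ * D))) :=
          mul_le_mul_of_nonneg_left h1 (mul_nonneg hC ha)
      _ = (∏ j ∈ Finset.range k, (1 + 50 * ((d : ℝ) + 1) * α j)) * Real.exp κ * Real.exp (-(κ * D)) * a := by ring
  by_cases h1 : c.1 = v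
  · rw [h1, tdist_self]
    exact hsup.trans (hcomp zero_le_one)
  · by_cases h2 : shift c.2 c.1 = v
    · have hD : tdist m c.1 v ≤ 1 := by rw [← h2]; exact tdist_shift_le_one hm c.1 c.2
      exact hsup.trans (hcomp hD)
    · rw [QkOfU_apply_eq_zero_of_support L m hL k U α hα1 hU1 hreg v A hAv c h1 h2, norm_zero]
      exact mul_nonneg (mul_nonneg (mul_nonneg hC (Real.exp_nonneg _)) (Real.exp_nonneg _)) ha

end Tower

/-! ## §3 The chain's `Q_{n+1}(U) = QkW` on the weighted `L²` carriers -/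

section Chain

variable {d : ℕ} (L : ℕ) [NeZero L] (m : Fin d → ℕ) [∀ i, NeZero (m i)] (n : ℕ)
  {𝔸 : Type*} [NormedRing 𝔸] [NormedAlgebra ℂ 𝔸] [CompleteSpace 𝔸] [NormOneClass 𝔸]
  {W : Type*} [NormedAddCommGroup W] [InnerProductSpace ℂ W] (φ : W ≃ₗ[ℂ] 𝔸) {c₀ c₁ : ℝ}
  (U : Bond d (towerP L m (n + 1)) → 𝔸ˣ) (hL : 1 ≤ L) (α : ℕ → ℝ) (hα1 : ∀ j, α j ≤ 1 / 64)
  (hU1 : ∀ (j : ℕ) (x : B7Prop1Explicit.Site d) (κ : Fin d), perCfg (towerP L m (j + 1)) (UlevOf L m (n + 1) U j) x κ ∈ U1 𝔸)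
  (hreg : ∀ (j : ℕ) (y : TSite d (towerP L m j)) (κ : Fin d) (r : Fin d → Fin L),
    ‖((Wcx L (perCfg (towerP L m (j + 1)) (UlevOf L m (n + 1) U j)) (cornerSite L y) κ (boxVec L r) : 𝔸ˣ) : 𝔸) - 1‖ ≤ α j)
  {Mφ Mφ' : ℝ} (hφ : ∀ w, ‖φ w‖ ≤ Mφ * ‖w‖) (hφ' : ∀ X, ‖φ.symm X‖ ≤ Mφ' * ‖X‖) (hMφ : 0 ≤ Mφ) (hMφ' : 0 ≤ Mφ')

include hφ hφ' hMφ hMφ' in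
/-- **THE LETTER (L) OF THE CHAIN's `Q_{n+1}(U) = B9Eq326OperatorTower.QkW`** (fibre read along `φ`): for `f` supported on the fine bonds based in the big
block `Π⁻¹(v)` with `‖f(b)‖ ≤ F`, every `κ ≥ 0` and every unit-lattice bond `c`,
`‖(Q_{n+1}(U)f)(c)‖ ≤ M_φ′·M_φ·(∏_{j<n+1}(1 + 50(d+1)α_j))·e^{κ}·e^{−κ·d_m(c₋,v)}·F` — VERBATIM the `hQl` binder of
`B9Eq3153FrakGkLocalLetter.local_letter_frakGk_of_letters`. [folklore] [cite: Balaban1985BackgroundPropagators, (3.15)–(3.16) p.393, Thm 3.1 (3.42) p.397; Balaban1985Averaging, (126)–(127) pp.36–37] -/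
theorem local_QkW (hm : ∀ i, 1 ≤ m i) {κ : ℝ} (hκ : 0 ≤ κ) (v : TSite d m) (f : BondL2K ℂ d (towerP L m (n + 1)) c₀ W) (F : ℝ)
    (hfv : ∀ b, blockCoord (L ^ (n + 1)) m (siteCast (towerP_eq_fineP_pow L m (n + 1)) (bpos b)) ≠ v →
      WL2.equiv ℂ (fun _ : Bond d (towerP L m (n + 1)) => c₀) W f b = 0)
    (hfF : ∀ b, ‖WL2.equiv ℂ (fun _ : Bond d (towerP L m (n + 1)) => c₀) W f b‖ ≤ F) (c : Bond d m) :
    ‖WL2.equiv ℂ (fun _ : Bond d m => c₁) W (QkW L m n φ U hL α hα1 hU1 hreg (c₀ := c₀) (c₁ := c₁) f) c‖ ≤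
      Mφ' * Mφ * (∏ j ∈ Finset.range (n + 1), (1 + 50 * (d + 1) * α j)) * Real.exp κ * Real.exp (-(κ * tdist m (bpos c) v)) * F := by
  rw [show WL2.equiv ℂ (fun _ : Bond d m => c₁) W (QkW L m n φ U hL α hα1 hU1 hreg (c₀ := c₀) (c₁ := c₁) f) c =
      φ.symm (QkOfU L m hL (n + 1) U α hα1 hU1 hreg (fun b => φ (WL2.equiv ℂ (fun _ : Bond d (towerP L m (n + 1)) => c₀) W f b)) c) from rfl]
  have h := local_QkOfU L m hL (n + 1) U α hα1 hU1 hreg hm hκ v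
    (fun b => φ (WL2.equiv ℂ (fun _ : Bond d (towerP L m (n + 1)) => c₀) W f b)) (Mφ * F)
    (fun b hb => by simp only [hfv b hb, map_zero]) (fun b => (hφ _).trans (mul_le_mul_of_nonneg_left (hfF b) hMφ)) c
  calc _ ≤ Mφ' * ‖QkOfU L m hL (n + 1) U α hα1 hU1 hreg (fun b => φ (WL2.equiv ℂ (fun _ : Bond d (towerP L m (n + 1)) => c₀) W f b)) c‖ :=
        hφ' _
    _ ≤ Mφ' * ((∏ j ∈ Finset.range (n + 1), (1 + 50 * ((d : ℝ) + 1) * α j)) * Real.exp κ * Real.exp (-(κ * tdist m c.1 v)) * (Mφ * F)) :=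
        mul_le_mul_of_nonneg_left h hMφ'
    _ = Mφ' * Mφ * (∏ j ∈ Finset.range (n + 1), (1 + 50 * (d + 1) * α j)) * Real.exp κ * Real.exp (-(κ * tdist m (bpos c) v)) * F := by
        rw [bpos]; ring

end Chain

end Literature.MathematicalPhysics.QuantumFieldTheory.Balaban1983to89.B9Eq315QkLocalLetter

end
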